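import Literature.NumberTheory.Sieve.CFSemigroupCongruenceOperatorBound
import Literature.NumberTheory.Sieve.CFSemigroupCongruenceNormCount
import Literature.NumberTheory.Sieve.CFSemigroupBowen
import HarnessLib

/-!
# Preparations for the power saving of the Frobenius-ball congruence count of `Γ_A`

[MageeOhWinter2019, §3.4, after Prop. 17]: the congruence Frobenius-ball count is recovered from the boundary
renewal counts of all suffixes `v ∈ A^N` (there: all `γ ∈ Γ^{(n)}`) with `N ≍ log R`, the suffix errors being summed
with the weights `e^{-(δ−ε)τ_*^n(γ)}` and controlled by the pressure ("`[𝓛^n_{-(δ−ε)}1] ≪ exp(nP(−(δ−ε)τ))`", (taubridged)).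
This file PROVES the `A`-side estimates for that summation, in the vocabulary of `CFSemigroupCongruenceNormCount`
(suffix data `C_v = |d_v(i)|²`, `x_v = M_v 0`, per-suffix constants `c_v = c_{𝟙,Φ₀}(x_v)`, `L_N`, `U_N`, `η̄_N = 2^{1−N}`):

* `cfQ_sq_le_Cv`: `q_v² ≤ C_v`; `cfCmax`, `cfEvenConst_le_cfCmax`: `c_v ≤ ½ e^{2δ}/(δκ_A)` uniformly;
* `cfClassLower_le`: `L_N ≤ c_max 4^δ` (partition function at `δ`, `Z_N(δ) ≤ 4^δ e^{N P(δ)} = 4^δ`);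
* `cfClassUpper_sub_cfClassLower_le`: `U_N − L_N ≤ 13·2δ·e^{2δ} c_max 4^δ · η̄_N`;
* `sum_aPlus_rpow_le`: `Σ_v a₊(v)^{2δ−θ} ≤ e^{2δ} 4^δ (B+1)^{θN}` for `0 ≤ θ ≤ 2δ` (`Z_N(δ−θ/2) ≤ 4^δ e^{N P(δ−θ/2)}` and
  `P(δ−θ/2) ≤ θ log(B+1)`, `B = max A`);
* `abs_cfCongCountT_sub_le_all`: from `cfCongCountT_powerSaving_of_operatorBound` (operator hypothesis, `Θ₀`, `G ≡ 1`), for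
  ALL `Y ≥ 0`, all suffix base points and start fibres: `|T(Y) − |Γ_q|^{-1}c Y^{2δ}| ≤ K_st Y^{2δ−θ} + K₀` with `K_st, K₀` affine in
  `M` with coefficients depending only on `A, σ₁, κ` (`cfKst`, `cfK0`).

## References
* [MageeOhWinter2019] M. Magee, H. Oh, D. Winter, J. reine angew. Math. 753 (2019), §3.4 (the estimates after Prop. 17, (taubridged)),
  Lemma 13.
-/

noncomputable section

open Complex Filter Set Metric Real
open scoped Topology MatrixGroups

namespace Literature.NumberTheory.Sieve

open Literature.NumberTheory.LFunctions

variable {A : Finset ℕ}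

/-! ### Suffix data: `q_v² ≤ C_v` -/

/-- `q_v² ≤ C_v = q'_v² + q_v²`. [folklore] -/
theorem cfQ_sq_le_Cv {N : ℕ} (v : Fin N → A) :
    (((cfQ fun i => ((v i : A) : ℕ)) : ℝ)) ^ 2 ≤ ‖cfDenC (cfMat fun i => ((v i : A) : ℕ)) Complex.I‖ ^ 2 := by
  rw [normSq_cfDenC_cfMat_I v, cfQ_eq]
  nlinarith [sq_nonneg (((cfMat (fun i => ((v i : A) : ℕ)) 1 0 : ℤ) : ℝ))]

/-! ### The uniform bound for the per-suffix constants -/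

section Constants

variable (A) (hA : ∀ a ∈ A, 1 ≤ a) (h2 : 2 ≤ A.card)

/-- `c_max = ½ e^{2δ}/(δ κ_A)`, a uniform bound for the per-suffix renewal constants `c_v`. [folklore] -/
def cfCmax : ℝ := 1 / 2 * Real.exp (2 * cfDimension A) / (cfDimension A * cfInt (cfNuδ A hA h2) (cfG A hA h2))

/-- `c_max > 0`. [folklore] -/
theorem cfCmax_pos : 0 < cfCmax A hA h2 := by
  unfold cfCmax
  exact div_pos (by positivity) (mul_pos (cfDimension_pos hA h2) (cfInt_cfG_pos A hA h2))

/-- **`c_v ≤ c_max`** for the threshold `Φ₀`, `G ≡ 1` and every base point (`∫ Φ₀^{-2δ} dν ≤ 1`, `h ≤ e^{2δ}`). [folklore] -/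
theorem cfEvenConst_le_cfCmax (x : Icc (0 : ℝ) 1) : cfEvenConst A hA h2 cfΘ₀ (CfLip.const 1) x ≤ cfCmax A hA h2 := by
  have hδ := cfDimension_pos hA h2
  have hκ := cfInt_cfG_pos A hA h2
  have hI : cfInt (cfNuδ A hA h2) (fun y => ((CfLip.const 1).extend y).re * cfΘ₀.Φ y ^ (-(2 * cfDimension A))) ≤ 1 := by
    have h1 : cfInt (cfNuδ A hA h2) (fun y => ((CfLip.const 1).extend y).re * cfΘ₀.Φ y ^ (-(2 * cfDimension A))) ≤
        cfInt (cfNuδ A hA h2) (fun _ => (1 : ℝ)) := by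
      unfold cfInt
      refine MeasureTheory.integral_mono_of_nonneg (Eventually.of_forall fun y => ?_) (MeasureTheory.integrable_const _)
        (Eventually.of_forall fun y => ?_)
      · show (0 : ℝ) ≤ ((CfLip.const 1).extend y).re * cfΘ₀.Φ y ^ (-(2 * cfDimension A))
        rw [show ((CfLip.const (1 : ℂ)).extend y) = 1 from rfl]
        simp only [Complex.one_re, one_mul]
        exact rpow_nonneg (cfΘ₀.pos y.2).le _
      · show ((CfLip.const 1).extend y).re * cfΘ₀.Φ y ^ (-(2 * cfDimension A)) ≤ 1
        rw [show ((CfLip.const (1 : ℂ)).extend y) = 1 from rfl]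
        simp only [Complex.one_re, one_mul]
        exact Real.rpow_le_one_of_one_le_of_nonpos (cfΘ₀.one_le _ y.2) (by linarith)
    rwa [cfInt_const] at h1
  have hh := cfHδ_le A hA h2 x.2
  have hhpos := cfHδ_pos A hA h2 x.2
  unfold cfEvenConst cfCmax
  rw [div_le_div_iff_of_pos_right (mul_pos hδ hκ)]
  nlinarith [mul_le_mul hI hh hhpos.le zero_le_one]

/-- `0 ≤ c_v`. [folklore] -/
theorem cfEvenConst_one_nonneg (x : Icc (0 : ℝ) 1) : 0 ≤ cfEvenConst A hA h2 cfΘ₀ (CfLip.const 1) x := by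
  have hδ := cfDimension_pos hA h2
  have hκ := cfInt_cfG_pos A hA h2
  unfold cfEvenConst
  refine div_nonneg (mul_nonneg (mul_nonneg (by norm_num) ?_) (cfHδ_pos A hA h2 x.2).le) (mul_pos hδ hκ).le
  refine MeasureTheory.integral_nonneg fun y => ?_
  show (0 : ℝ) ≤ ((CfLip.const 1).extend y).re * cfΘ₀.Φ y ^ (-(2 * cfDimension A))
  rw [show ((CfLip.const (1 : ℂ)).extend y) = 1 from rfl]
  simp only [Complex.one_re, one_mul]
  exact rpow_nonneg (cfΘ₀.pos y.2).le _

/-! ### `L_N` is bounded, `U_N − L_N = O(η̄_N)`, and the pressure bound for `Σ_v a₊(v)^{2δ−θ}` -/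

/-- The scaling factor `a(v) = e^{c}/√C_v` raised to `e ≥ 0` is at most `e^{c e} (q_v²)^{-e/2}` (`q_v² ≤ C_v`). [folklore] -/
theorem scale_rpow_le (hA : ∀ a ∈ A, 1 ≤ a) {N : ℕ} (v : Fin N → A) (c : ℝ) {e : ℝ} (he : 0 ≤ e) :
    (Real.exp c / Real.sqrt (‖cfDenC (cfMat fun i => ((v i : A) : ℕ)) Complex.I‖ ^ 2)) ^ e ≤
      Real.exp (c * e) * ((((cfQ fun i => ((v i : A) : ℕ)) : ℝ)) ^ 2) ^ (-(e / 2)) := by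
  have hq : (1 : ℝ) ≤ ((cfQ fun i => ((v i : A) : ℕ)) : ℝ) := one_le_cfQ_cast hA v
  set C := ‖cfDenC (cfMat fun i => ((v i : A) : ℕ)) Complex.I‖ ^ 2 with hCdef
  have hC0 : 0 < C := lt_of_lt_of_le one_pos (one_le_normSq_cfDenC hA v)
  rw [div_rpow (Real.exp_pos c).le (Real.sqrt_nonneg _), ← Real.exp_mul, Real.sqrt_eq_rpow, ← Real.rpow_mul hC0.le,
    show (1 / 2 : ℝ) * e = e / 2 by ring, div_eq_mul_inv, ← Real.rpow_neg hC0.le]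
  exact mul_le_mul_of_nonneg_left (Real.rpow_le_rpow_of_nonpos (by positivity) (cfQ_sq_le_Cv v) (by linarith))
    (Real.exp_pos _).le

/-- **`L_N ≤ c_max 4^δ`** (`Z_N(δ) ≤ 4^δ e^{N P(δ)}`, `P(δ) = 0`). [cite: MageeOhWinter2019, §3.4 ("`[𝓛^n_{-δ}1](γ₀k₀) ≪ 1`")] -/
theorem cfClassLower_le (N : ℕ) : cfClassLower A hA h2 N ≤ cfCmax A hA h2 * (4 : ℝ) ^ cfDimension A := by
  have hne := nonempty_of_two_le_card h2
  have hδ := cfDimension_pos hA h2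
  have hcmax := (cfCmax_pos A hA h2).le
  unfold cfClassLower
  calc ∑ v : Fin N → A, (Real.exp (-(5 * cfEtaBar N)) / Real.sqrt (‖cfDenC (cfMat fun i => ((v i : A) : ℕ)) Complex.I‖ ^ 2)) ^
          (2 * cfDimension A) * cfEvenConst A hA h2 cfΘ₀ (CfLip.const 1) (cfXvI A hA v)
      ≤ ∑ v : Fin N → A, ((((cfQ fun i => ((v i : A) : ℕ)) : ℝ)) ^ 2) ^ (-cfDimension A) * cfCmax A hA h2 := by
        refine Finset.sum_le_sum fun v _ => ?_
        have h1 := scale_rpow_le A hA v (-(5 * cfEtaBar N)) (e := 2 * cfDimension A) (by linarith)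
        have h2' : Real.exp (-(5 * cfEtaBar N) * (2 * cfDimension A)) ≤ 1 :=
          Real.exp_le_one_iff.2 (by nlinarith [cfEtaBar_nonneg N])
        have hpow : 0 ≤ ((((cfQ fun i => ((v i : A) : ℕ)) : ℝ)) ^ 2) ^ (-cfDimension A) := by positivity
        rw [show -(2 * cfDimension A / 2) = -cfDimension A by ring] at h1
        exact mul_le_mul (h1.trans (by nlinarith)) (cfEvenConst_le_cfCmax A hA h2 _) (cfEvenConst_one_nonneg A hA h2 _) hpow
    _ = cfPartition A N (cfDimension A) * cfCmax A hA h2 := by rw [cfPartition, Finset.sum_mul]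
    _ ≤ (4 : ℝ) ^ cfDimension A * Real.exp (N * cfPressure A (cfDimension A)) * cfCmax A hA h2 :=
        mul_le_mul_of_nonneg_right (cfPartition_le_exp hA hne hδ.le N) hcmax
    _ = cfCmax A hA h2 * (4 : ℝ) ^ cfDimension A := by rw [cfPressure_cfDimension hA h2, mul_zero, Real.exp_zero, mul_one, mul_comm]

/-- `e^x − 1 ≤ x e^x` (a private copy of the lemma in `PolynomialCongruencesProofs`, to keep the imports light). [folklore] -/
private theorem cfExp_sub_one_le_mul_exp (x : ℝ) : Real.exp x - 1 ≤ x * Real.exp x := by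
  have h := Real.add_one_le_exp (-x)
  have hpos := Real.exp_pos x
  have hprod : Real.exp x * Real.exp (-x) = 1 := by rw [← Real.exp_add, add_neg_cancel, Real.exp_zero]
  nlinarith [mul_le_mul_of_nonneg_left h hpos.le]

/-- **`U_N − L_N ≤ 13 · 2δ · e^{2δ} c_max 4^δ · η̄_N`** for `η̄_N ≤ 1/16` (`U_N = e^{13η̄_N 2δ} L_N`). [folklore] -/
theorem cfClassUpper_sub_cfClassLower_le {N : ℕ} (hN : cfEtaBar N ≤ 1 / 16) :
    cfClassUpper A hA h2 N - cfClassLower A hA h2 N ≤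
      13 * (2 * cfDimension A) * Real.exp (2 * cfDimension A) * (cfCmax A hA h2 * (4 : ℝ) ^ cfDimension A) * cfEtaBar N := by
  have hδ := cfDimension_pos hA h2
  have hη := cfEtaBar_nonneg N
  have hL0 : 0 ≤ cfClassLower A hA h2 N := by
    unfold cfClassLower
    exact Finset.sum_nonneg fun v _ => mul_nonneg (rpow_nonneg (div_nonneg (Real.exp_pos _).le (Real.sqrt_nonneg _)) _)
      (cfEvenConst_one_nonneg A hA h2 _)
  have hL := cfClassLower_le A hA h2 N
  set x : ℝ := 13 * cfEtaBar N * (2 * cfDimension A) with hxdef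
  have hx0 : 0 ≤ x := by positivity
  have hx1 : x ≤ 2 * cfDimension A := by rw [hxdef]; nlinarith
  rw [cfClassUpper_eq A hA h2 N, ← hxdef, ← sub_one_mul]
  have h1 : Real.exp x - 1 ≤ x * Real.exp (2 * cfDimension A) :=
    (cfExp_sub_one_le_mul_exp x).trans (mul_le_mul_of_nonneg_left (Real.exp_le_exp.2 hx1) hx0)
  calc (Real.exp x - 1) * cfClassLower A hA h2 N ≤ x * Real.exp (2 * cfDimension A) * (cfCmax A hA h2 * (4 : ℝ) ^ cfDimension A) :=
        mul_le_mul h1 hL hL0 (by positivity)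
    _ = _ := by rw [hxdef]; ring

/-- **The pressure bound for the suffix weights:** for `0 ≤ θ ≤ 2δ`,
`Σ_{v ∈ A^N} a₊(v)^{2δ−θ} ≤ e^{2δ} 4^δ exp(N θ log(B+1))` (`B = max A`): `Z_N(δ − θ/2) ≤ 4^{δ−θ/2} e^{N P(δ−θ/2)}` and
`P(δ−θ/2) ≤ P(δ) + θ log(B+1) = θ log(B+1)`. [cite: MageeOhWinter2019, §3.4 (taubridged)] -/
theorem sum_aPlus_rpow_le (hA : ∀ a ∈ A, 1 ≤ a) (h2 : 2 ≤ A.card) {N : ℕ} (hN : cfEtaBar N ≤ 1 / 16) {θ : ℝ} (hθ0 : 0 ≤ θ)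
    (hθ : θ ≤ 2 * cfDimension A) :
    ∑ v : Fin N → A, (Real.exp (8 * cfEtaBar N) / Real.sqrt (‖cfDenC (cfMat fun i => ((v i : A) : ℕ)) Complex.I‖ ^ 2)) ^
        (2 * cfDimension A - θ) ≤
      Real.exp (2 * cfDimension A) * (4 : ℝ) ^ cfDimension A * Real.exp (N * (θ * Real.log ((A.sup id : ℕ) + 1))) := by
  have hne := nonempty_of_two_le_card h2
  have hδ := cfDimension_pos hA h2
  have hη := cfEtaBar_nonneg N
  have hB : ∀ a ∈ A, a ≤ A.sup id := fun a ha => Finset.le_sup (f := id) ha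
  set s : ℝ := cfDimension A - θ / 2 with hs
  have hs0 : 0 ≤ s := by rw [hs]; linarith
  have hsδ : s ≤ cfDimension A := by rw [hs]; linarith
  -- termwise
  have hterm : ∀ v : Fin N → A,
      (Real.exp (8 * cfEtaBar N) / Real.sqrt (‖cfDenC (cfMat fun i => ((v i : A) : ℕ)) Complex.I‖ ^ 2)) ^ (2 * cfDimension A - θ) ≤
        Real.exp (2 * cfDimension A) * ((((cfQ fun i => ((v i : A) : ℕ)) : ℝ)) ^ 2) ^ (-s) := by
    intro v
    have h1 := scale_rpow_le A hA v (8 * cfEtaBar N) (e := 2 * cfDimension A - θ) (by linarith)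
    rw [show -((2 * cfDimension A - θ) / 2) = -s by rw [hs]; ring] at h1
    refine h1.trans (mul_le_mul_of_nonneg_right (Real.exp_le_exp.2 (by nlinarith)) (by positivity))
  -- the pressure bound
  have hP : cfPressure A s ≤ θ * Real.log ((A.sup id : ℕ) + 1) := by
    have h := sub_le_cfPressure hA hne hB hs0 hsδ
    rw [cfPressure_cfDimension hA h2] at h
    have : 2 * (cfDimension A - s) = θ := by rw [hs]; ring
    rw [this] at h
    linarith
  have h4 : (4 : ℝ) ^ s ≤ (4 : ℝ) ^ cfDimension A := Real.rpow_le_rpow_of_exponent_le (by norm_num) hsδ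
  calc ∑ v : Fin N → A, (Real.exp (8 * cfEtaBar N) / Real.sqrt (‖cfDenC (cfMat fun i => ((v i : A) : ℕ)) Complex.I‖ ^ 2)) ^
          (2 * cfDimension A - θ)
      ≤ ∑ v : Fin N → A, Real.exp (2 * cfDimension A) * ((((cfQ fun i => ((v i : A) : ℕ)) : ℝ)) ^ 2) ^ (-s) :=
        Finset.sum_le_sum fun v _ => hterm v
    _ = Real.exp (2 * cfDimension A) * cfPartition A N s := by rw [cfPartition, Finset.mul_sum]
    _ ≤ Real.exp (2 * cfDimension A) * ((4 : ℝ) ^ s * Real.exp (N * cfPressure A s)) :=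
        mul_le_mul_of_nonneg_left (cfPartition_le_exp hA hne hs0 N) (Real.exp_pos _).le
    _ ≤ Real.exp (2 * cfDimension A) * ((4 : ℝ) ^ cfDimension A * Real.exp (N * (θ * Real.log ((A.sup id : ℕ) + 1)))) := by
        gcongr
    _ = _ := by ring

end Constants

/-! ### The per-suffix bounds for all radii from the operator hypothesis -/

section PerSuffix

variable (A) (hA : ∀ a ∈ A, 1 ≤ a) (h2 : 2 ≤ A.card) (q : ℕ) [NeZero q]

/-- The error coefficient of the engine: `K_M(σ₁, κ) = (32/π) 2^{2+σ₁} S(σ₁, κ)`. [folklore] -/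
def cfKM (σ₁ κ : ℝ) : ℝ := 32 / π * 2 ^ (2 + σ₁) * PerronTwo.shiftConst σ₁ κ

/-- The residue-part constant `C_res = e^{2δ}/κ_A` (for `Φ₀`, `G ≡ 1`: `Λ = 1`, `‖1‖ ≤ 1`). [folklore] -/
def cfCres : ℝ := Real.exp (2 * cfDimension A) / cfInt (cfNuδ A hA h2) (cfG A hA h2)

/-- The power-saving coefficient `K_st(M) = c_max δ (2^{δ+1} + 1/δ) + (M + C_res) K_M`, affine in `M`. [folklore] -/
def cfKst (σ₁ κ M : ℝ) : ℝ :=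
  cfCmax A hA h2 * cfDimension A * (2 ^ (cfDimension A + 1) + 1 / cfDimension A) + (M + cfCres A hA h2) * cfKM σ₁ κ

/-- The small-radius constant `K₀(M) = 2 c_max 2^δ + K_st(M) 2^δ`. [folklore] -/
def cfK0 (σ₁ κ M : ℝ) : ℝ := 2 * cfCmax A hA h2 * (2 : ℝ) ^ cfDimension A + cfKst A hA h2 σ₁ κ M * (2 : ℝ) ^ cfDimension A

variable {A q}

/-- `K_M ≥ 0`. [folklore] -/
theorem cfKM_nonneg {σ₁ κ : ℝ} (hσ₁ : 0 < σ₁) : 0 ≤ cfKM σ₁ κ := by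
  unfold cfKM; have := PerronTwo.shiftConst_nonneg (κ := κ) hσ₁; positivity

/-- `K_st ≥ 0` for `M ≥ 0`. [folklore] -/
theorem cfKst_nonneg {σ₁ κ M : ℝ} (hσ₁ : 0 < σ₁) (hM : 0 ≤ M) : 0 ≤ cfKst A hA h2 σ₁ κ M := by
  have := cfCmax_pos A hA h2; have := cfDimension_pos hA h2; have := cfKM_nonneg (κ := κ) hσ₁
  have : 0 ≤ cfCres A hA h2 := div_nonneg (Real.exp_pos _).le (cfInt_cfG_pos A hA h2).le
  unfold cfKst; positivity

/-- **The per-suffix power saving for `Y ≥ √2`, uniformly:** under the unit hypotheses and the sup-norm operator bound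
for the threshold `Φ₀`, `G ≡ 1`, target fibre `1`: for every start fibre `g` and base point `x`,
`|T(Y) − |Γ_q|^{-1} c(x) Y^{2δ}| ≤ K_st(M) Y^{2δ − 2(δ−σ₁)/3}`. [cite: MageeOhWinter2019, §3.4] -/
theorem abs_cfCongCountT_sub_le_of_ge {σ₀ σ₁ : ℝ} (hσ₀ : 0 ≤ σ₀) (hσ₀₁ : σ₀ < σ₁) (hσ₁ : σ₁ < cfDimension A)
    (hL1 : ∀ s : ℂ, σ₀ < s.re → s ≠ (cfDimension A : ℂ) → IsUnit (1 - cfLOp A hA s))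
    (hL2 : ∀ s : ℂ, σ₀ < s.re → IsUnit (1 + cfLOp A hA s))
    (hB : ∀ s : ℂ, σ₀ < s.re → IsUnit (1 - cfTwB A hA q s))
    {κ M : ℝ} (hκ0 : 0 ≤ κ) (hκ : κ < 2) (hM : 0 ≤ M)
    (hop : ∀ u : ℝ, σ₁ ≤ u → u ≤ cfDimension A + 1 → ∀ t : ℝ, (u : ℂ) + t * I ≠ (cfDimension A : ℂ) →
      ∀ (η : SL(2, ZMod q)) (y : Icc (0 : ℝ) 1),
        ‖(cfTwHop A hA h2 q ((u : ℂ) + t * I) (cfFamS q cfΘ₀ (CfLip.const 1) 1 ((u : ℂ) + t * I))) η y‖ ≤ M * (1 + |t|) ^ κ)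
    (g : SL(2, ZMod q)) (x : Icc (0 : ℝ) 1) {Y : ℝ} (hY : Real.sqrt 2 ≤ Y) :
    |cfCongCountT A cfΘ₀ (CfLip.const 1) g 1 Y x -
        ((Fintype.card (SL(2, ZMod q)) : ℝ))⁻¹ * cfEvenConst A hA h2 cfΘ₀ (CfLip.const 1) x * Y ^ (2 * cfDimension A)| ≤
      cfKst A hA h2 σ₁ κ M * Y ^ (2 * cfDimension A - 2 * ((cfDimension A - σ₁) / 3)) := by
  have hδ := cfDimension_pos hA h2
  have hκpos := cfInt_cfG_pos A hA h2
  have hσ₁0 : 0 < σ₁ := lt_of_le_of_lt hσ₀ hσ₀₁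
  have hGre : ∀ y : Icc (0 : ℝ) 1, ((((CfLip.const (1 : ℂ)) y).re : ℝ) : ℂ) = (CfLip.const (1 : ℂ)) y := fun y => by simp
  have hG0 : ∀ y : Icc (0 : ℝ) 1, 0 ≤ ((CfLip.const (1 : ℂ)) y).re := fun y => by simp
  have h := cfCongCountT_powerSaving_of_operatorBound hA h2 cfΘ₀ hGre hG0 1 hσ₀ hσ₀₁ hσ₁ hL1 hL2 hB hκ0 hκ hM hop g x hY
  have hmain : cfCongResid q cfΘ₀ hA h2 (CfLip.const 1) x * Y ^ (2 * cfDimension A) / cfDimension A =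
      ((Fintype.card (SL(2, ZMod q)) : ℝ))⁻¹ * cfEvenConst A hA h2 cfΘ₀ (CfLip.const 1) x * Y ^ (2 * cfDimension A) := by
    rw [cfCongResid_eq]; field_simp
  rw [hmain] at h
  refine h.trans (mul_le_mul_of_nonneg_right ?_ (rpow_nonneg (by linarith [Real.sqrt_nonneg 2]) _))
  -- comparison of the constants
  have hr : cfCongResid q cfΘ₀ hA h2 (CfLip.const 1) x ≤ cfCmax A hA h2 * cfDimension A := by
    rw [cfCongResid_eq]
    have hc := cfEvenConst_le_cfCmax A hA h2 x
    have hc0 := cfEvenConst_one_nonneg A hA h2 x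
    have hcard1 : ((Fintype.card (SL(2, ZMod q)) : ℝ))⁻¹ ≤ 1 :=
      inv_le_one_of_one_le₀ (by exact_mod_cast Fintype.card_pos)
    calc ((Fintype.card (SL(2, ZMod q)) : ℝ))⁻¹ * (cfDimension A * cfEvenConst A hA h2 cfΘ₀ (CfLip.const 1) x)
        ≤ 1 * (cfDimension A * cfCmax A hA h2) := mul_le_mul hcard1 (by nlinarith) (by positivity) zero_le_one
      _ = cfCmax A hA h2 * cfDimension A := by ring
  have hres : cfΘ₀.Λ * ‖CfLip.const (1 : ℂ)‖ * Real.exp (2 * cfDimension A) / cfInt (cfNuδ A hA h2) (cfG A hA h2) ≤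
      cfCres A hA h2 := by
    have h1 : ‖CfLip.const (1 : ℂ)‖ ≤ 1 := (CfLip.norm_const_le 1).trans (by simp)
    have hΛ : cfΘ₀.Λ = 1 := rfl
    rw [hΛ, one_mul, cfCres]
    exact div_le_div_of_nonneg_right (by nlinarith [Real.exp_pos (2 * cfDimension A)]) hκpos.le
  have hKM := cfKM_nonneg (κ := κ) hσ₁0
  unfold cfKst
  rw [show (32 / π * 2 ^ (2 + σ₁) * PerronTwo.shiftConst σ₁ κ) = cfKM σ₁ κ from rfl]
  have hk1 : 0 ≤ (2 : ℝ) ^ (cfDimension A + 1) + 1 / cfDimension A := by positivity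
  nlinarith [mul_le_mul_of_nonneg_right hr hk1, mul_le_mul_of_nonneg_right (add_le_add_left hres M) hKM]

/-- **The per-suffix bound for all radii `Y ≥ 0`:** `|T(Y) − |Γ_q|^{-1} c(x) Y^{2δ}| ≤ K_st(M) Y^{2δ−2(δ−σ₁)/3} + K₀(M)`
(monotonicity of `T` below `√2`). [folklore] -/
theorem abs_cfCongCountT_sub_le_all {σ₀ σ₁ : ℝ} (hσ₀ : 0 ≤ σ₀) (hσ₀₁ : σ₀ < σ₁) (hσ₁ : σ₁ < cfDimension A)
    (hL1 : ∀ s : ℂ, σ₀ < s.re → s ≠ (cfDimension A : ℂ) → IsUnit (1 - cfLOp A hA s))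
    (hL2 : ∀ s : ℂ, σ₀ < s.re → IsUnit (1 + cfLOp A hA s))
    (hB : ∀ s : ℂ, σ₀ < s.re → IsUnit (1 - cfTwB A hA q s))
    {κ M : ℝ} (hκ0 : 0 ≤ κ) (hκ : κ < 2) (hM : 0 ≤ M)
    (hop : ∀ u : ℝ, σ₁ ≤ u → u ≤ cfDimension A + 1 → ∀ t : ℝ, (u : ℂ) + t * I ≠ (cfDimension A : ℂ) →
      ∀ (η : SL(2, ZMod q)) (y : Icc (0 : ℝ) 1),
        ‖(cfTwHop A hA h2 q ((u : ℂ) + t * I) (cfFamS q cfΘ₀ (CfLip.const 1) 1 ((u : ℂ) + t * I))) η y‖ ≤ M * (1 + |t|) ^ κ)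
    (g : SL(2, ZMod q)) (x : Icc (0 : ℝ) 1) {Y : ℝ} (hY : 0 ≤ Y) :
    |cfCongCountT A cfΘ₀ (CfLip.const 1) g 1 Y x -
        ((Fintype.card (SL(2, ZMod q)) : ℝ))⁻¹ * cfEvenConst A hA h2 cfΘ₀ (CfLip.const 1) x * Y ^ (2 * cfDimension A)| ≤
      cfKst A hA h2 σ₁ κ M * Y ^ (2 * cfDimension A - 2 * ((cfDimension A - σ₁) / 3)) + cfK0 A hA h2 σ₁ κ M := by
  have hδ := cfDimension_pos hA h2
  have hσ₁0 : 0 < σ₁ := lt_of_le_of_lt hσ₀ hσ₀₁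
  have hKst := cfKst_nonneg hA h2 (κ := κ) hσ₁0 hM
  have hcmax := (cfCmax_pos A hA h2).le
  have h2δ : (0 : ℝ) ≤ (2 : ℝ) ^ cfDimension A := by positivity
  have hYpθ : 0 ≤ Y ^ (2 * cfDimension A - 2 * ((cfDimension A - σ₁) / 3)) := rpow_nonneg hY _
  have hK0ge : cfCmax A hA h2 * (2 : ℝ) ^ cfDimension A + cfKst A hA h2 σ₁ κ M * (2 : ℝ) ^ cfDimension A ≤
      cfK0 A hA h2 σ₁ κ M := by
    unfold cfK0; nlinarith [mul_nonneg hcmax h2δ]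
  have hcq0 : 0 ≤ ((Fintype.card (SL(2, ZMod q)) : ℝ))⁻¹ * cfEvenConst A hA h2 cfΘ₀ (CfLip.const 1) x :=
    mul_nonneg (by positivity) (cfEvenConst_one_nonneg A hA h2 x)
  have hcq1 : ((Fintype.card (SL(2, ZMod q)) : ℝ))⁻¹ * cfEvenConst A hA h2 cfΘ₀ (CfLip.const 1) x ≤ cfCmax A hA h2 := by
    calc ((Fintype.card (SL(2, ZMod q)) : ℝ))⁻¹ * cfEvenConst A hA h2 cfΘ₀ (CfLip.const 1) x
        ≤ 1 * cfCmax A hA h2 := mul_le_mul (inv_le_one_of_one_le₀ (by exact_mod_cast Fintype.card_pos))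
          (cfEvenConst_le_cfCmax A hA h2 x) (cfEvenConst_one_nonneg A hA h2 x) zero_le_one
      _ = _ := one_mul _
  by_cases hYs : Real.sqrt 2 ≤ Y
  · have h := abs_cfCongCountT_sub_le_of_ge hA h2 hσ₀ hσ₀₁ hσ₁ hL1 hL2 hB hκ0 hκ hM hop g x hYs
    have hK0 : 0 ≤ cfK0 A hA h2 σ₁ κ M := by unfold cfK0; positivity
    linarith
  · rw [not_le] at hYs
    have hs2 : Real.sqrt 2 ^ (2 * cfDimension A) = (2 : ℝ) ^ cfDimension A := by
      rw [Real.sqrt_eq_rpow, ← Real.rpow_mul (by norm_num), show (1 / 2 : ℝ) * (2 * cfDimension A) = cfDimension A by ring]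
    have hs2' : Real.sqrt 2 ^ (2 * cfDimension A - 2 * ((cfDimension A - σ₁) / 3)) ≤ (2 : ℝ) ^ cfDimension A := by
      rw [← hs2]
      exact Real.rpow_le_rpow_of_exponent_le (Real.one_le_sqrt.2 (by norm_num)) (by linarith)
    have hYp : Y ^ (2 * cfDimension A) ≤ (2 : ℝ) ^ cfDimension A := by
      rw [← hs2]; exact Real.rpow_le_rpow hY hYs.le (by linarith)
    have hT0 : 0 ≤ cfCongCountT A cfΘ₀ (CfLip.const 1) g 1 Y x := cfCongCountT_nonneg A cfΘ₀ (fun y => by simp) g 1 _ _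
    have hTmono : cfCongCountT A cfΘ₀ (CfLip.const 1) g 1 Y x ≤ cfCongCountT A cfΘ₀ (CfLip.const 1) g 1 (Real.sqrt 2) x :=
      cfCongCountT_mono A hA cfΘ₀ (fun y => by simp) g 1 x.2 hYs.le
    have hT2 := abs_cfCongCountT_sub_le_of_ge hA h2 hσ₀ hσ₀₁ hσ₁ hL1 hL2 hB hκ0 hκ hM hop g x (le_refl (Real.sqrt 2))
    rw [hs2, abs_le] at hT2
    -- `T(√2) ≤ c 2^δ + K_st (√2)^{p-θ} ≤ c_max 2^δ + K_st 2^δ`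
    have hT2' : cfCongCountT A cfΘ₀ (CfLip.const 1) g 1 (Real.sqrt 2) x ≤
        cfCmax A hA h2 * (2 : ℝ) ^ cfDimension A + cfKst A hA h2 σ₁ κ M * (2 : ℝ) ^ cfDimension A := by
      have := hT2.2
      nlinarith [mul_le_mul_of_nonneg_left hs2' hKst, mul_le_mul_of_nonneg_right hcq1 h2δ]
    have hcY : ((Fintype.card (SL(2, ZMod q)) : ℝ))⁻¹ * cfEvenConst A hA h2 cfΘ₀ (CfLip.const 1) x * Y ^ (2 * cfDimension A) ≤
        cfCmax A hA h2 * (2 : ℝ) ^ cfDimension A := mul_le_mul hcq1 hYp (rpow_nonneg hY _) hcmax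
    have hcY0 : 0 ≤ ((Fintype.card (SL(2, ZMod q)) : ℝ))⁻¹ * cfEvenConst A hA h2 cfΘ₀ (CfLip.const 1) x * Y ^ (2 * cfDimension A) :=
      mul_nonneg hcq0 (rpow_nonneg hY _)
    rw [abs_le]
    constructor
    · nlinarith [mul_nonneg hKst hYpθ]
    · nlinarith [mul_nonneg hKst hYpθ]

end PerSuffix

end Literature.NumberTheory.Sieve
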